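import Mathlib

/-!
# Beta / WhichBetaMarginal — kernel certificate of the ONE [analysis] step of `HOME/b2b-balaban-beta-d4-p2/WHICH-BETA.md`
# (row D4 co-owner #2, unit `b2b-balaban-beta-d4-p2`, gen 3; cell GAPS C-d4p2-5, DIVERGENCE D-d4p2-3):
# a MARGINAL leftover cannot sit inside the (2.43)/(3.67) error class of [Balaban1988Convergent] unless its coefficient is 0

HONEST FRAMING (page 1 of everything the β sub-cell writes): discharging `BetaPertH` makes Bałaban's UV stability
UNCONDITIONAL — a real constructive-QFT result; it is NOT the continuum limit and NOT the Clay problem.  HONEST DEPENDENCY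
(cell reorg 2026-08-19, verbatim): «continuum YM on T⁴ ⇐ BetaPertH ∧ nine spine estimates (0/9 proved); BetaPertH ⇐ (D1) ∧
(D4) ∧ CAP+tail; G-an2-4 gates asym, D1 and NE2/3/4.»  THIS MODULE ASSERTS NOTHING ABOUT BAŁABAN'S OBJECTS: it is
[folklore] real analysis (polynomial lower bound × geometric upper bound ⇒ the constant is 0), recorded because it is the
only inferential step of the reading «WHICH β» — everything else there is a definition-chase through printed displays.

ABSOLUTE RULE (cell charter, verbatim): "No internally-minted statement may enter as a cited fact. Every hypothesis is
either kernel-proved in this package or a verbatim quotation of a PUBLISHED theorem with page reference. The manuscript(s)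
under audit are NOT citable for their own disputed steps — they are the thing under adjudication; programme-internal
(2001/route/tribunal) claims are never citable."  Nothing is cited as a fact here.

## The step this certifies (WHICH-BETA.md §1 [analysis])

[Balaban1988Convergent] (= [III]) p. 283 (3.67): `𝐄^{(j)}(Λ_j, U_k, z) − 𝐄^{(j)}(Λ_j, 1, z) − β_jA(h_z, U_k) =
O((L^jL^{−n})^{5−β})`, obtained from (3.61) + (3.64) («β′_j = β_j. This is the required equality») + (3.66) by EXACT
cancellation of the marginal term `β′_j·½Σ_{μ<ν}tr F²_{μν}(z)` against `β_j·½Σtr F²(z)`.  If the subtracted β_j were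
the read-out of a DIFFERENT cut-off family (τ_j := β′_j − β_j ≠ 0), the left side would retain `τ_j·½Σtr F²(z)`, of
size `τ_j·m_n` with `m_n ≍ ε_n²(L^jL^{−n})⁴` on the admissible fields of scale n ((2.27)/(3.48); the cell's order count
C-adv6-19), while the class is `C·(L^jL^{−n})^{5−β}`, β < 1.  With `k := n − j`, `s_k := L^{−k}`: the leftover is
`|τ|·e_k·s_k⁴`, the class `C·s_k⁴·r^k` with `r := L^{β−1} ∈ ]0,1[`, and `e_k ≍ ε_{j+k}²` decays at most POLYNOMIALLY in
k along an asymptotically free trajectory (`g_n² ≍ 1/n`, `ε_n = g_n·A₀(log g_n⁻²)^{p₀}`).  §1: polynomial lower bound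
`c/k^q ≤ e_k` and `|τ|·e_k ≤ C·r^k` for all `k ≥ 1` force `τ = 0`.  §2: the same with the common factor `s_k⁴` displayed,
and the identity `s_k⁴·r^k = L^{−(5−β)k}` (the printed class).  So p. 283's cancellation is an identity ONLY for the
β-family read out of [III]'s own (3.16)-cut-off whole-lattice terms — the content of (W) in WHICH-BETA.md.  Nothing
else is claimed; in particular no bound on any β is proved here.
-/

namespace Summit.QuantumFields.BalabanUV.Beta.WhichBetaMarginal

open Filter Topology

/-! ## §1 Polynomial lower bound × geometric upper bound ⇒ the coefficient vanishes -/

/-- [folklore] If `e_k ≥ c/k^q` (`c > 0`) and `|τ|·e_k ≤ C·r^k` for all `k ≥ 1` with `0 ≤ r < 1`, then `τ = 0`: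
`|τ|·c ≤ C·k^q·r^k → 0`. -/
theorem eq_zero_of_polyLower_geomUpper {τ c C r : ℝ} {q : ℕ} {e : ℕ → ℝ} (hc : 0 < c) (hr : 0 ≤ r) (hr1 : r < 1)
    (hlow : ∀ k : ℕ, 1 ≤ k → c / (k : ℝ) ^ q ≤ e k) (hup : ∀ k : ℕ, 1 ≤ k → |τ| * e k ≤ C * r ^ k) : τ = 0 := by
  -- for k ≥ 1: |τ|·c ≤ C · (k^q · r^k)
  have hk : ∀ k : ℕ, 1 ≤ k → |τ| * c ≤ C * ((k : ℝ) ^ q * r ^ k) := by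
    intro k hk1
    have hkpos : 0 < (k : ℝ) ^ q := by positivity
    have h1 : |τ| * (c / (k : ℝ) ^ q) ≤ |τ| * e k := mul_le_mul_of_nonneg_left (hlow k hk1) (abs_nonneg τ)
    have h2 : |τ| * (c / (k : ℝ) ^ q) ≤ C * r ^ k := h1.trans (hup k hk1)
    have h3 : |τ| * c ≤ C * r ^ k * (k : ℝ) ^ q := by
      have := mul_le_mul_of_nonneg_right h2 hkpos.le
      rwa [mul_assoc, div_mul_cancel₀ c hkpos.ne'] at this
    linarith [h3, show C * r ^ k * (k : ℝ) ^ q = C * ((k : ℝ) ^ q * r ^ k) by ring]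
  -- k^q · r^k → 0
  have hlim : Tendsto (fun k : ℕ => C * ((k : ℝ) ^ q * r ^ k)) atTop (𝓝 (C * 0)) :=
    (tendsto_pow_const_mul_const_pow_of_abs_lt_one q (abs_lt.mpr ⟨by linarith, hr1⟩)).const_mul C
  rw [mul_zero] at hlim
  have hle : |τ| * c ≤ 0 :=
    ge_of_tendsto hlim (Filter.eventually_atTop.mpr ⟨1, fun k hk1 => hk k hk1⟩)
  have habs : |τ| ≤ 0 := le_of_mul_le_mul_right (by rw [zero_mul]; exact hle) hc
  exact abs_eq_zero.mp (le_antisymm habs (abs_nonneg τ))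

/-! ## §2 In the letters of (3.67): the common factor `s_k⁴ = (L^jL^{−n})⁴` displayed, `r = L^{β−1}` -/

/-- [folklore] For `L > 1`, `β < 1`: `r := L^{β−1} ∈ ]0,1[`. -/
theorem ratio_mem_Ioo {L β : ℝ} (hL : 1 < L) (hβ : β < 1) : 0 < L ^ (β - 1) ∧ L ^ (β - 1) < 1 :=
  ⟨Real.rpow_pos_of_pos (by linarith) _, Real.rpow_lt_one_of_one_lt_of_neg hL (by linarith)⟩

/-- [folklore] The printed class `(L^jL^{−n})^{5−β}` IS `s_k⁴·r^k` with `s_k = L^{−k}`, `r = L^{β−1}`, `k = n − j`: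
`(L^{−k})⁴·(L^{β−1})^k = L^{−(5−β)k}` (`L > 0`). -/
theorem class_eq {L β : ℝ} (hL : 0 < L) (k : ℕ) :
    (L ^ (-(k : ℝ))) ^ 4 * (L ^ (β - 1)) ^ k = L ^ (-(5 - β) * k) := by
  rw [← Real.rpow_natCast (L ^ (-(k : ℝ))) 4, ← Real.rpow_mul hL.le, ← Real.rpow_natCast (L ^ (β - 1)) k,
    ← Real.rpow_mul hL.le, ← Real.rpow_add hL]
  congr 1
  push_cast
  ring

/-- [folklore] **THE CERTIFICATE.**  Let `L > 1`, `β < 1`, `s_k := L^{−k}` (the scale ratio `L^jL^{−n}`, `k = n − j`).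
If the marginal monomial has a POLYNOMIAL lower bound `e_k ≥ c/k^q` (`c > 0`, all `k ≥ 1`) and the leftover
`|τ|·e_k·s_k⁴` lies in the class `C·s_k⁴·(L^{β−1})^k = C·L^{−(5−β)k}` for all `k ≥ 1`, then `τ = 0`.  (The factor
`s_k⁴ > 0` cancels; then §1.) -/
theorem marginal_leftover_forces_zero {L β τ c C : ℝ} {q : ℕ} {e : ℕ → ℝ} (hL : 1 < L) (hβ : β < 1) (hc : 0 < c)
    (hlow : ∀ k : ℕ, 1 ≤ k → c / (k : ℝ) ^ q ≤ e k)
    (hclass : ∀ k : ℕ, 1 ≤ k →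
      |τ| * e k * (L ^ (-(k : ℝ))) ^ 4 ≤ C * (L ^ (-(k : ℝ))) ^ 4 * (L ^ (β - 1)) ^ k) : τ = 0 := by
  obtain ⟨hr0, hr1⟩ := ratio_mem_Ioo hL hβ
  refine eq_zero_of_polyLower_geomUpper (C := C) hc hr0.le hr1 hlow fun k hk1 => ?_
  have hs : 0 < (L ^ (-(k : ℝ))) ^ 4 := pow_pos (Real.rpow_pos_of_pos (by linarith) _) 4
  have h := hclass k hk1
  rw [show C * (L ^ (-(k : ℝ))) ^ 4 * (L ^ (β - 1)) ^ k = C * (L ^ (β - 1)) ^ k * (L ^ (-(k : ℝ))) ^ 4 by ring] at h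
  exact le_of_mul_le_mul_right h hs

/-- [folklore] The same certificate with the class written as the PRINTED power `C·L^{−(5−β)k}` of (3.67)/(2.43). -/
theorem marginal_leftover_forces_zero' {L β τ c C : ℝ} {q : ℕ} {e : ℕ → ℝ} (hL : 1 < L) (hβ : β < 1) (hc : 0 < c)
    (hlow : ∀ k : ℕ, 1 ≤ k → c / (k : ℝ) ^ q ≤ e k)
    (hclass : ∀ k : ℕ, 1 ≤ k → |τ| * e k * (L ^ (-(k : ℝ))) ^ 4 ≤ C * L ^ (-(5 - β) * k)) : τ = 0 :=
  marginal_leftover_forces_zero hL hβ hc hlow fun k hk1 => by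
    rw [mul_assoc C, class_eq (by linarith) k]; exact hclass k hk1

/-- [folklore] NON-VACUITY of the hypotheses with `τ = 0` (so the certificate is not an ex-falso): `L = 2`, `β = 0`,
`e_k = 1/k`, `c = 1`, `q = 1`, `C = 0`. -/
example : ∃ (e : ℕ → ℝ), (∀ k : ℕ, 1 ≤ k → (1 : ℝ) / (k : ℝ) ^ 1 ≤ e k) ∧
    (∀ k : ℕ, 1 ≤ k → |(0 : ℝ)| * e k * ((2 : ℝ) ^ (-(k : ℝ))) ^ 4 ≤ 0 * (2 : ℝ) ^ (-(5 - 0) * (k : ℝ))) :=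
  ⟨fun k => 1 / (k : ℝ), fun k _ => by simp, fun k _ => by simp⟩

end Summit.QuantumFields.BalabanUV.Beta.WhichBetaMarginal
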